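import Summits.QuantumFields.YangMills.Theorems.BalabanUVNodesN22W1StripAnyReading
import Literature.MathematicalPhysics.QuantumFieldTheory.Balaban1983to89.Node00.RateRecordW1MapsAdm

/-!
# BalabanUVNodes ∕ node N22 = NE9 — THE STRIP INDUCTION AT THE W1 OBJECT, MODULE 13: THE CHAIN AT THE ADMISSIBLE READING OF RECORD `ReadingData.ofRecordAdm` —
# module 12 §1 with the readings-in-the-spaces clause DISCHARGED BY TYPE (`LevelPairing.ofRecordAdm_embA_mem`) and the pairing coherence by `rfl` ∕ `pairOfRecord`'s faces

Cell `pub-ymgap`, HUMAN RULING D-0062 (Track A), R134 ACCELERATION re-seat `pub-ymgap-dag-n22-c` (strategy s1), generation 3, module 13 = the instance of module 12 at the repair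
(R1) of this seat's LOCATED-BGA (`Node00/RateRecordW1MapsAdm.lean`: admissible-background slots).  THEOREMS ONLY; imports module 12 `…N22W1StripAnyReading` (p479386) and
`Node00.RateRecordW1MapsAdm` BY NAME.  `--supports` K3′ (helper).

WHAT.
* §1 `pairingCoherence_ofRecordAdm` — module 9's (C1)(C2) for `ReadingData.ofRecordAdm F M N S sp gauge hg T₀ hT₀ li` (`rfl` ∕ `dj_pairOfRecord` ∕ `range_pairOfRecord` ∕ `⟨U, rfl⟩`:
  run B of pairing `k` and run A of pairing `k+1` are the SAME subtype `AdmBg F M N sp (k+1)`).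
* §2 `n22At_u3OfRecord₁₂_ofRecordAdm_of_n18Below_termwise226StripOlder_eHoloAt` — `N22At` at the level-`k` bundle of the ADMISSIBLE reading of record whose table family at
  run length `k` IS the space table of record `U^c_j(Y, cs.α₀, cs.α₁)` of the §2 setting `Sg` (hypothesis `hspk : sp k = fun j Y ↦ spaceI Sg Rz M j (domSites …) cs.α₀ cs.α₁`):
  hypotheses = the older-coupling level-T hypothesis (N10) + the `EHoloAt` family (N09) + N18 below + (J) + numerals — NO readings clause, NO coherence clause.

HONEST FRAMING.  Count-neutral by-name knit; NOT a discharge of N22; `T₀`'s admissibility preservation is a parameter of the reading (displayed there); NE5 ∕ NE9 NOT IN PRINT;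
one finite four-torus programme at fixed ε — NOT infinite volume, NOT OS on ℝ⁴, NOT a mass gap, NOT Clay.  0 `sorry`, 0 `def`, standard axioms.
-/

noncomputable section

open scoped Matrix.Norms.L2Operator

namespace YMDAG.N22.W1

open Set Metric
open scoped BigOperators
open Literature.MathematicalPhysics.QuantumFieldTheory.Balaban1983to89
open Literature.MathematicalPhysics.QuantumFieldTheory.Balaban1983to89.T4Continuum
open Literature.MathematicalPhysics.QuantumFieldTheory.Balaban1983to89.T4OutputRate
open Literature.MathematicalPhysics.QuantumFieldTheory.Balaban1983to89.TreeLengthTorus (TPt TDom tsys torusTreeLen torusTreeLen_nonneg)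
open Literature.MathematicalPhysics.QuantumFieldTheory.Balaban1983to89.B12TreeDecay (K₀ K₀_pos)
open Literature.MathematicalPhysics.QuantumFieldTheory.Balaban1983to89.B13Lemma3TorusData (TBond)
open Literature.MathematicalPhysics.QuantumFieldTheory.Balaban1983to89.B13Lemma3TorusTerms (terms weight)
open Literature.MathematicalPhysics.QuantumFieldTheory.Balaban1983to89.B13Lemma3TorusSocket (Lemma3Numerics)
open Literature.MathematicalPhysics.QuantumFieldTheory.Balaban1983to89.B12BetaHolo (EHoloAt)
open Literature.MathematicalPhysics.QuantumFieldTheory.Balaban1983to89.Step (SFConsts)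
open Literature.MathematicalPhysics.QuantumFieldTheory.Balaban1983to89.Node00
  (Stage12Params IsDatumOfRecord₁₂C U3Objects₁₁ U3Letters₁₁ MatA ιSU prependCoupling)
open Literature.MathematicalPhysics.QuantumFieldTheory.Balaban1983to89.Node00.Sect2 (domSys domCount CPair ofBackgroundC spaceI domSites Setting Residual)
open Literature.MathematicalPhysics.QuantumFieldTheory.Balaban1983to89.Node00.W1
open YMDAG.UVSplit

variable {N : ℕ} [NeZero N]

section AdmRecord

variable {F : T4Family} {M : ℕ} (S : (k : ℕ) → ClusterTower (F.P k) (MatA N) M)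
  (sp : (k j : ℕ) → (domSys (F.P k) M j).Dom → Set (CPair (F.P k) (MatA N)))
  (gauge : (k : ℕ) → GaugeField (F.P k) 0 (Node00.SU N) → GaugeField (F.P k) 0 (Node00.SU N) → ℝ) (hg : ∀ k U U', 0 ≤ gauge k U U')
  (T₀ : (k : ℕ) → GaugeField (F.P (k + 1)) 0 (Node00.SU N) → GaugeField (F.P k) 0 (Node00.SU N))
  (hT₀ : ∀ (k : ℕ) (U : GaugeField (F.P (k + 1)) 0 (Node00.SU N)),
    (∀ (j : ℕ) (Y : (domSys (F.P (k + 1)) M j).Dom), ofBackgroundC (ιSU N) U ∈ sp (k + 1) j Y) →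
    ∀ (j : ℕ) (Y : (domSys (F.P k) M j).Dom), ofBackgroundC (ιSU N) (T₀ k U) ∈ sp k j Y)
  (li : LetterInputs)

omit [NeZero N] in
/-- **THE PAIRING COHERENCE (C1)(C2) AT THE ADMISSIBLE READING OF RECORD**: (C1) by `pairOfRecord_fst` (`rfl`), `dj_pairOfRecord`, `range_pairOfRecord`; (C2) by `⟨U, rfl⟩` — run B
of pairing `k` and run A of pairing `k+1` are the same subtype `AdmBg F M N sp (k+1)` read by `(ι·, 0) ∘ Subtype.val`. [folklore] -/
theorem pairingCoherence_ofRecordAdm :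
    (∀ (k : ℕ) (X₁ : Node00.W1.Dom (F.P k) M), (((ReadingData.ofRecordAdm F M N S sp gauge hg T₀ hT₀ li).pairing k).pair X₁).1 = X₁.1 + 1) ∧
    (∀ (k : ℕ) (X₁ : Node00.W1.Dom (F.P k) M),
      (domSys (F.P (k + 1)) M (((ReadingData.ofRecordAdm F M N S sp gauge hg T₀ hT₀ li).pairing k).pair X₁).1).dj
          (((ReadingData.ofRecordAdm F M N S sp gauge hg T₀ hT₀ li).pairing k).pair X₁).2 = (domSys (F.P k) M X₁.1).dj X₁.2) ∧
    (∀ (k : ℕ) (X : Node00.W1.Dom (F.P (k + 1)) M), 1 ≤ X.1 →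
      ∃ X₁ : Node00.W1.Dom (F.P k) M, ((ReadingData.ofRecordAdm F M N S sp gauge hg T₀ hT₀ li).pairing k).pair X₁ = X) ∧
    (∀ (k : ℕ) (U : ((ReadingData.ofRecordAdm F M N S sp gauge hg T₀ hT₀ li).pairing (k + 1)).BgA),
      ∃ U₁ : ((ReadingData.ofRecordAdm F M N S sp gauge hg T₀ hT₀ li).pairing k).BgB,
        ((ReadingData.ofRecordAdm F M N S sp gauge hg T₀ hT₀ li).pairing k).embB U₁ =
          ((ReadingData.ofRecordAdm F M N S sp gauge hg T₀ hT₀ li).pairing (k + 1)).embA U) := by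
  refine ⟨fun k X₁ => rfl, fun k X₁ => dj_pairOfRecord F M k X₁, fun k X hX => ?_, fun k U => ⟨U, rfl⟩⟩
  have hX' : X ∈ Set.range (pairOfRecord F M k) := by
    rw [range_pairOfRecord]
    exact Nat.one_le_iff_ne_zero.mp hX
  exact hX'

variable (θ : Stage12Params F N) (k : ℕ) {G : Type*} [GaugeGroup G]
  (Sg : Setting (MatA N) G) (Rz : Residual (F.P k) (MatA N)) (logZ : ℕ → GaugeField (F.P k) 0 G → ℝ) (β : ℕ → ℝ → ℝ)

open Classical in
/-- **`N22At` AT THE LEVEL-`k` BUNDLE OF THE ADMISSIBLE READING OF RECORD — readings clause and coherence DISCHARGED BY TYPE.**  For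
`D := ReadingData.ofRecordAdm F M N S sp gauge hg T₀ hT₀ li` whose run-length-`k` table IS the space table of record of the §2 setting `Sg` at N09's radii
(`hspk : ∀ j Y, sp k j Y = U^c_j(Y, cs.α₀, cs.α₁)`): the older-coupling level-T hypothesis for `S k` (N10), an `EHoloAt` family on `sfTowerOfRecord Sg Rz M (S k) ⟨g, β⟩ logZ`
(N09; `H.E₀ ≤ li.A`, `li.r ≤ H.r`, `θ.γ ≤ cs.γ`, `li.κ ≤ cs.κ`), `∀ k′ < k, N18At (u3OfRecord₁₂ θ (D.u3Objects θ.γ) k′)` (N18), the pin (J) for the towers, the socket numerals + S25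
+ renewal, the letter signs ⟹ `N22At (u3OfRecord₁₂ θ (D.u3Objects θ.γ) k)`. [folklore] -/
theorem n22At_u3OfRecord₁₂_ofRecordAdm_of_n18Below_termwise226StripOlder_eHoloAt [NeZero M] {cs : SFConsts}
    (hspk : ∀ (j : ℕ) (Y : (domSys (F.P k) M j).Dom), sp k j Y = spaceI Sg Rz M j (domSites (F.P k) M j Y) cs.α₀ cs.α₁)
    (c : B13.Consts) {L : ℕ} [NeZero L] (hL : 8 ≤ c.L) (hLc : c.L = L) {a a₂ a₂' a₅ Aabs : ℝ}
    (hN : Lemma3Numerics c M ((c.L : ℝ) / 2) a a₂ a₂' a₅ Aabs) {r₁ : ℝ} (hA0 : 0 ≤ c.C3act * c.ε₁) (hr₁ : 0 ≤ r₁) (hκ : li.κ ≤ r₁)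
    (hrate : r₁ + 2 * (64 * Real.log 162) + 2 ≤ (1 - 8 * c.δ) * ((c.L : ℝ) / 2) * c.κ)
    (hsmall : c.C3act * c.ε₁ * Real.exp (5 * r₁ + 1) * K₀ 64 8 * 9 * 64 ≤ 1)
    (hrenew : Real.exp 1 * 9 * 64 * K₀ 64 8 ^ 2 * (c.C3act * c.ε₁) ≤ li.A) (hγc : θ.γ ≤ cs.γ) (hκc : li.κ ≤ cs.κ)
    (h226TOlder : ∀ (k' : ℕ) (g : ℕ → ℝ), g ∈ Window θ.γ → ∀ (i : ℕ), i < k' → ∀ (X : (domSys (F.P k) M (k' + 1)).Dom) (φ : CPair (F.P k) (MatA N)),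
      φ ∈ spaceI Sg Rz M (k' + 1) (domSites (F.P k) M (k' + 1) X) cs.α₀ cs.α₁ →
      (∀ (j : ℕ), j < k' + 1 → ∀ (Y : (domSys (F.P k) M j).Dom) (ψ : CPair (F.P k) (MatA N)), ψ ∈ spaceI Sg Rz M j (domSites (F.P k) M j Y) cs.α₀ cs.α₁ →
        ∃ (Ec : ℂ → ℂ) (O : Set ℂ), IsOpen O ∧ (∀ t ∈ Ioc (0 : ℝ) θ.γ, closedBall (t : ℂ) li.r ⊆ O) ∧ DifferentiableOn ℂ Ec O ∧
          (∀ z ∈ O, ‖Ec z‖ ≤ li.A * Real.exp (-(li.κ * torusTreeLen Y.1))) ∧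
          (∀ t ∈ Ioc (0 : ℝ) θ.γ, Ec t = termC (S k) j Y (Function.update g i t) ψ)) →
      ∃ (Hc : ℂ → TDom 4 (domCount (F.P k) M (k' + 1)) → ℂ)
        (Tt : (Z : TDom 4 (domCount (F.P k) M (k' + 1))) →
          Finset (TDom 4 (L * domCount (F.P k) M (k' + 1))) × Finset (TBond 4 M (L * domCount (F.P k) M (k' + 1))) → ℂ → ℂ)
        (O : Set ℂ), IsOpen O ∧ (∀ t ∈ Ioc (0 : ℝ) θ.γ, closedBall (t : ℂ) li.r ⊆ O) ∧
        (∀ Z : (domSys (F.P k) M (k' + 1)).Dom, Z.1 ⊆ X.1 → DifferentiableOn ℂ (fun z => Hc z Z) O) ∧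
        (∀ z ∈ O, ∀ Z : TDom 4 (domCount (F.P k) M (k' + 1)), Z.1 ⊆ X.1 → ‖Hc z Z‖ ≤ ∑ t ∈ terms L M Z, ‖Tt Z t z‖) ∧
        (∀ z ∈ O, ∀ Z : TDom 4 (domCount (F.P k) M (k' + 1)), Z.1 ⊆ X.1 → ∀ t ∈ terms L M Z,
          ‖Tt Z t z‖ ≤ weight L M c Z a t * Real.exp (a₅ * ((Z.1).card : ℝ))) ∧
        (∀ t ∈ Ioc (0 : ℝ) θ.γ, Hc t = ((S k) k').H (restrictPrefix k' (Function.update g i t)) φ))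
    (hE : ∀ g ∈ Window θ.γ, ∀ k' : ℕ, ∃ H : EHoloAt (sfTowerOfRecord Sg Rz M (S k) ⟨g, β⟩ logZ) cs k', H.E₀ ≤ li.A ∧ li.r ≤ H.r)
    (hjunk : ∀ (k : ℕ) (X : Node00.W1.Dom (F.P k) M), k < X.1 → ∀ (g : ℕ → ℝ) (φ : CPair (F.P k) (MatA N)), functionalC (S k) g φ X = 0)
    (h18 : ∀ k' : ℕ, k' < k → N18At (u3OfRecord₁₂ θ ((ReadingData.ofRecordAdm F M N S sp gauge hg T₀ hT₀ li).u3Objects θ.γ) k'))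
    (hC5 : 0 ≤ li.C₅) (hθ1 : li.θ₅ < 1) (hC₀' : 2 * li.C₅ / (1 - li.θ₅) ≤ li.C₀)
    (hC₀ : 0 < li.C₀) (hθ : 0 < li.θ₅) (hA : 0 < li.A) (hμ1 : 1 ≤ li.μ) (hθμ : li.θ₅ ≤ li.μ) (hCM : li.C₀ ≤ 2 * li.A)
    (hr : 0 < li.r) (hγ : 0 < θ.γ) (hs0 : 0 < li.s) (hs1 : li.s < 1) :
    N22At (u3OfRecord₁₂ θ ((ReadingData.ofRecordAdm F M N S sp gauge hg T₀ hT₀ li).u3Objects θ.γ) k) := by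
  obtain ⟨hfst, hdj, hsurj, hbg⟩ := pairingCoherence_ofRecordAdm (N := N) S sp gauge hg T₀ hT₀ li
  refine n22At_u3OfRecord₁₂_w1Reading_of_n18Below_termwise226StripOlder_eHoloAt θ (ReadingData.ofRecordAdm F M N S sp gauge hg T₀ hT₀ li) k Sg Rz logZ β
    (fun j U Y => ?_) c hL hLc hN hA0 hr₁ hκ hrate hsmall hrenew hγc hκc h226TOlder hE hfst hdj hsurj hbg (fun k₁ h U₁ X₁ hk₁ => ?_) h18
    hC5 hθ1 hC₀' hC₀ hθ hA hμ1 hθμ hCM hr hγ hs0 hs1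
  · rw [← hspk j Y]
    exact U.2 j Y
  · show (functionalC (S k₁) h (ofBackgroundC (ιSU N) U₁.1) X₁).re = 0
    rw [hjunk k₁ X₁ hk₁]
    simp

end AdmRecord

end YMDAG.N22.W1

end
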